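import Summits.AtomisticToContinuum.Crystallization.Theorems.FrustratedLawDichotomyBumpNearFieldSixB

/-!
# FrustratedLawDichotomy · ★★ `SF₆` — the RANGE-6 Schur floor `SchurFloor (cutWeight smoothstep₂ 4 6) omega₂ (13/8000)` IS A THEOREM:
# the near-field certificate assembled (`a = 1`, `w₆` quintic on `[4, 6]`, `A₆ = 13/8000`)

Range-6 twin of hand-1 g13's `…BumpSF5` (decomp-a2c, prover hand 2, generation 19; design memo HOME/decomp-a2c-hand-2/g19/RANGE6-DESIGN.md).
`…BumpKappaSix.sf₆_of_nearIneq6` reduced `SF₆` to ONE inequality on `r ∈ (4, 7]`; `…NearFieldSixA/B` (generated from exact rationals) supply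
`qpoly6 ≤ s⁻⁵` (`≥ 0`) on `[23/5, 9]`, the integrand tables, the window integrals `H6…` and SEVEN Bernstein certificates
`r·sec(r)·w₆(r) ≤ 6K₀·H6(r)`, `K₀ = 11025/20790`; the inner-integral minorant `mpoly5 ≤ 10/39 − Pbar5` and the inner-integral lemmas are the
range-5 ones (bump radius `1` unchanged).  This file: `w₆` is the quintic `10x³ − 15x⁴ + 6x⁵`, `x = (r−4)/2`, on `[4, 6]`; the `s`-integrand,
its minorant, window lemmas (kinds A0/A/B/C with window `2`, ramp window `[23/5, 5]`), and ★★ `sf₆_holds`.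
Consumer: `…CollarCensusZeroRangeCut.aperiodicFrustratedLawGap_of_collarPiecesKK_milli_unionT_zero_range6 sf₆_holds` — the 27623 T-side
zero-tolerance tight-collar line at RANGE 6 (Schur slack `5.15·10⁻⁴` per site instead of `1.15·10⁻³` at `9/2`).
[folklore]; 0 sorry.  `--supports stmt-AtomisticToContinuum-27623`.
-/

noncomputable section

namespace Summit.AtomisticToContinuum.Crystallization.Theorems.FrustratedLawDichotomyBumpAutocorrelation

open MeasureTheory Set Real
open scoped BigOperators
open Literature.MathematicalPhysics.StatisticalMechanics (lennardJones)
open Summit.AtomisticToContinuum.Crystallization.Theorems.FrustratedLawDichotomySchurCut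
  (omega₂ omega₂_of_two_le SchurFloor tailPot cutWeight smoothstep₂)

/-! ## §1. The tail weight on the window -/

/-- On `[4, 6]`: `w₆ r = 10x³ − 15x⁴ + 6x⁵`, `x = (r − 4)/2`. [folklore] -/
theorem w6_eq_quintic {r : ℝ} (h1 : 4 ≤ r) (h2 : r ≤ 6) :
    cutWeight smoothstep₂ 4 6 r = 10 * ((r - 4) / 2) ^ 3 - 15 * ((r - 4) / 2) ^ 4 + 6 * ((r - 4) / 2) ^ 5 := by
  unfold cutWeight smoothstep₂
  rw [show (6 : ℝ) - 4 = 2 by norm_num]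
  have hx0 : 0 ≤ (r - 4) / 2 := by positivity
  have hx1 : (r - 4) / 2 ≤ 1 := by rw [div_le_one (by norm_num)]; linarith
  split_ifs with ha hb
  · have : (r - 4) / 2 = 0 := le_antisymm ha hx0
    rw [this]; norm_num
  · have : (r - 4) / 2 = 1 := le_antisymm hx1 hb
    rw [this]; norm_num
  · rfl

/-- Above the window the range-6 tail weight is one. [folklore] -/
theorem w6_eq_one {r : ℝ} (h : 6 ≤ r) : cutWeight smoothstep₂ 4 6 r = 1 := by
  have hx : 1 ≤ (r - 4) / (6 - 4) := by rw [le_div_iff₀ (by norm_num : (0:ℝ) < 6 - 4)]; linarith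
  have hx' : ¬ (r - 4) / (6 - 4) ≤ 0 := by linarith
  simp [cutWeight, smoothstep₂, hx, hx']

/-! ## §2. The `s`-integrand: sign, integrability, minorisation (inner integral = the range-5 one, bump radius `1`) -/

/-- The full `s`-integrand at range 6. -/
def sInt6 (r s : ℝ) : ℝ := s * kappa6 s * ∫ τ in |r - s|..(r + s), τ * omega₂ τ

/-- `sInt6 r` is continuous. [folklore] -/
theorem continuous_sInt6 (r : ℝ) : Continuous (sInt6 r) := by
  unfold sInt6
  exact (continuous_id.mul continuous_kappa6).mul (continuous_inner5 r)

/-- `sInt6 r s ≥ 0` for `s ≥ 0`, `r ≥ 0`. [folklore] -/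
theorem sInt6_nonneg {r s : ℝ} (hr : 0 ≤ r) (hs : 0 ≤ s) : 0 ≤ sInt6 r s := by
  unfold sInt6
  refine mul_nonneg (mul_nonneg hs (kappa6_nonneg s)) (inner5_nonneg ?_)
  rw [abs_le]; constructor <;> linarith

/-- `sInt6 r s = 0` for `s ≥ r + 2` (`r ≥ 0`). [folklore] -/
theorem sInt6_eq_zero {r s : ℝ} (hr : 0 ≤ r) (hs : r + 2 ≤ s) : sInt6 r s = 0 := by
  unfold sInt6
  have habs : |r - s| = s - r := by rw [abs_sub_comm, abs_of_nonneg (by linarith)]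
  rw [inner5_eq_zero (by rw [habs]; linarith) (by rw [habs]; linarith), mul_zero]

/-- `sInt6 r` is integrable on `(0, ∞)` (`r ≥ 0`). [folklore] -/
theorem integrableOn_sInt6 {r : ℝ} (hr : 0 ≤ r) : IntegrableOn (sInt6 r) (Ioi 0) :=
  (integrableOn_Ici_of_eq_zero (continuous_sInt6 r) (a := 0) (fun _ hs => sInt6_eq_zero hr hs)).mono_set Ioi_subset_Ici_self

/-- The minorised integrand `(6M)⁻¹·qpoly6(s)·ramp6(s)·mpoly5(|r − s|)`. -/
def gInt6 (r s : ℝ) : ℝ := (6 * tailConst5)⁻¹ * (qpoly6 s * ramp6 s * mpoly5 |r - s|)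

/-- `gInt6 r` is continuous. [folklore] -/
theorem continuous_gInt6 (r : ℝ) : Continuous (gInt6 r) := by
  unfold gInt6
  exact continuous_const.mul ((continuous_qpoly6.mul continuous_ramp6).mul (continuous_mpoly5.comp (continuous_abs.comp (by fun_prop))))

/-- On the window: `gInt6 r s ≤ sInt6 r s` (`0 ≤ qpoly6 ≤ s⁻⁵` on `[23/5, 9]`, `ramp6 ≥ 0`, `mpoly5 ≤` inner integral `= 10/39 − Pbar5|r−s| ≥ 0`).
[folklore] -/
theorem gInt6_le_sInt6 {r s : ℝ} (hs1 : 23 / 5 ≤ s) (hs2 : s ≤ 9) (hrs : |r - s| ≤ 2) (hr : 4 ≤ r) : gInt6 r s ≤ sInt6 r s := by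
  have hs0 : 0 < s := by linarith
  have hin : ∫ τ in |r - s|..(r + s), τ * omega₂ τ = 10 / 39 - Pbar5 |r - s| := inner5_eq hrs (by linarith)
  have hΩ : 0 ≤ 10 / 39 - Pbar5 |r - s| := by linarith [Pbar5_le (abs_nonneg (r - s)) hrs]
  have hm : mpoly5 |r - s| ≤ 10 / 39 - Pbar5 |r - s| := mpoly5_le (abs_nonneg _) hrs
  have hκ : s * kappa6 s = (6 * tailConst5)⁻¹ * ((s⁻¹) ^ 5 * ramp6 s) := by
    rw [kappa6, max_eq_left (by linarith)]
    field_simp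
  unfold gInt6 sInt6
  rw [hin, hκ]
  have hq := qpoly6_le hs1 hs2
  have hq0 := qpoly6_nonneg hs1 hs2
  have hramp := (ramp6_mem_Icc s).1
  have hM : 0 ≤ (6 * tailConst5)⁻¹ := by have := tailConst5_pos; positivity
  have h1 : qpoly6 s * ramp6 s * mpoly5 |r - s| ≤ qpoly6 s * ramp6 s * (10 / 39 - Pbar5 |r - s|) :=
    mul_le_mul_of_nonneg_left hm (mul_nonneg hq0 hramp)
  have h2 : qpoly6 s * ramp6 s * (10 / 39 - Pbar5 |r - s|) ≤ (s⁻¹) ^ 5 * ramp6 s * (10 / 39 - Pbar5 |r - s|) :=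
    mul_le_mul_of_nonneg_right (mul_le_mul_of_nonneg_right hq hramp) hΩ
  nlinarith [h1, h2, hM]

/-- ★ **The `s`-integral dominates the minorised window integral**: for `4 ≤ r`, `lo ≥ 23/5`, `r − 2 ≤ lo ≤ r + 2 ≤ 9`:
`∫_{lo}^{r+2} gInt6 r ≤ ∫_{s>0} sInt6 r`. [folklore] -/
theorem window_le_integral6 {r lo : ℝ} (hr : 4 ≤ r) (hlo1 : 23 / 5 ≤ lo) (hlo2 : r - 2 ≤ lo) (hlo3 : lo ≤ r + 2)
    (hhi : r + 2 ≤ 9) :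
    ∫ s in lo..(r + 2), gInt6 r s ≤ ∫ s in Ioi 0, sInt6 r s := by
  have hr0 : 0 ≤ r := by linarith
  have h1 : ∫ s in lo..(r + 2), gInt6 r s ≤ ∫ s in lo..(r + 2), sInt6 r s := by
    refine intervalIntegral.integral_mono_on hlo3 ((continuous_gInt6 r).intervalIntegrable _ _)
      ((continuous_sInt6 r).intervalIntegrable _ _) fun s hs => ?_
    refine gInt6_le_sInt6 (by linarith [hs.1]) (by linarith [hs.2]) ?_ hr
    rw [abs_le]; constructor <;> linarith [hs.1, hs.2]
  have h2 : ∫ s in lo..(r + 2), sInt6 r s ≤ ∫ s in Ioi 0, sInt6 r s := by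
    rw [intervalIntegral.integral_of_le hlo3]
    refine setIntegral_mono_set (integrableOn_sInt6 hr0) ?_ (Filter.Eventually.of_forall fun s hs => lt_trans (show (0:ℝ) < lo by linarith) hs.1)
    exact (ae_restrict_iff' measurableSet_Ioi).mpr (Filter.Eventually.of_forall fun s (hs : 0 < s) => sInt6_nonneg hr0 hs.le)
  exact h1.trans h2

/-! ## §3. The window integral in closed form (kinds A0/A/B/C, ramp window `[23/5, 5]`) -/

/-- Kind A0 (`4 ≤ r ≤ 23/5`): `∫_{23/5}^{r+2} gInt6 r = (6M)⁻¹ (H6A01 + H6A02)(r)`. [folklore] -/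
theorem window6_A0 {r : ℝ} (h1 : 4 ≤ r) (h2 : r ≤ 23 / 5) :
    ∫ s in (23 / 5 : ℝ)..(r + 2), gInt6 r s = (6 * tailConst5)⁻¹ * (H6A01 r + H6A02 r) := by
  have hc := continuous_gInt6 r
  rw [← intervalIntegral.integral_add_adjacent_intervals (hc.intervalIntegrable (23 / 5) (5)) (hc.intervalIntegrable (5) (r + 2))]
  have e1 : ∫ s in (23 / 5 : ℝ)..(5), gInt6 r s = (6 * tailConst5)⁻¹ * H6A01 r := by
    rw [← integral_H6A01, ← intervalIntegral.integral_const_mul]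
    refine intervalIntegral.integral_congr fun s hs => ?_
    rw [uIcc_of_le (by norm_num)] at hs
    simp only [gInt6]
    rw [ramp6_of_mem hs.1 hs.2, abs_of_nonpos (by linarith [hs.1]), neg_sub, ← integrand_cU4]
  have e2 : ∫ s in (5 : ℝ)..(r + 2), gInt6 r s = (6 * tailConst5)⁻¹ * H6A02 r := by
    rw [← integral_H6A02, ← intervalIntegral.integral_const_mul]
    refine intervalIntegral.integral_congr fun s hs => ?_
    rw [uIcc_of_le (by linarith)] at hs
    simp only [gInt6]
    rw [ramp6_of_ge hs.1, mul_one, abs_of_nonpos (by linarith [hs.1]), neg_sub, ← integrand_cU3]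
  rw [e1, e2]; ring

/-- Kind A (`23/5 ≤ r ≤ 5`): `∫_{23/5}^{r+2} gInt6 r = (6M)⁻¹ (H6A1 + H6A2 + H6A3)(r)`. [folklore] -/
theorem window6_A {r : ℝ} (h1 : 23 / 5 ≤ r) (h2 : r ≤ 5) :
    ∫ s in (23 / 5 : ℝ)..(r + 2), gInt6 r s = (6 * tailConst5)⁻¹ * (H6A1 r + H6A2 r + H6A3 r) := by
  have hc := continuous_gInt6 r
  rw [← intervalIntegral.integral_add_adjacent_intervals (hc.intervalIntegrable (23 / 5) r) (hc.intervalIntegrable r (r + 2)),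
    ← intervalIntegral.integral_add_adjacent_intervals (hc.intervalIntegrable r (5)) (hc.intervalIntegrable (5) (r + 2))]
  have e1 : ∫ s in (23 / 5 : ℝ)..r, gInt6 r s = (6 * tailConst5)⁻¹ * H6A1 r := by
    rw [← integral_H6A1, ← intervalIntegral.integral_const_mul]
    refine intervalIntegral.integral_congr fun s hs => ?_
    rw [uIcc_of_le h1] at hs
    simp only [gInt6]
    rw [ramp6_of_mem hs.1 (by linarith [hs.2]), abs_of_nonneg (by linarith [hs.2]), ← integrand_cU1]
  have e2 : ∫ s in r..(5 : ℝ), gInt6 r s = (6 * tailConst5)⁻¹ * H6A2 r := by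
    rw [← integral_H6A2, ← intervalIntegral.integral_const_mul]
    refine intervalIntegral.integral_congr fun s hs => ?_
    rw [uIcc_of_le h2] at hs
    simp only [gInt6]
    rw [ramp6_of_mem (by linarith [hs.1]) hs.2, abs_of_nonpos (by linarith [hs.1]), neg_sub, ← integrand_cU4]
  have e3 : ∫ s in (5 : ℝ)..(r + 2), gInt6 r s = (6 * tailConst5)⁻¹ * H6A3 r := by
    rw [← integral_H6A3, ← intervalIntegral.integral_const_mul]
    refine intervalIntegral.integral_congr fun s hs => ?_
    rw [uIcc_of_le (by linarith)] at hs
    simp only [gInt6]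
    rw [ramp6_of_ge hs.1, mul_one, abs_of_nonpos (by linarith [hs.1]), neg_sub, ← integrand_cU3]
  rw [e1, e2, e3]; ring

/-- Kind B (`5 ≤ r`; used for `r ≤ 33/5`): `∫_{23/5}^{r+2} gInt6 r = (6M)⁻¹ (H6B1 + H6B2 + H6B3)(r)`. [folklore] -/
theorem window6_B {r : ℝ} (h1 : 5 ≤ r) :
    ∫ s in (23 / 5 : ℝ)..(r + 2), gInt6 r s = (6 * tailConst5)⁻¹ * (H6B1 r + H6B2 r + H6B3 r) := by
  have hc := continuous_gInt6 r
  rw [← intervalIntegral.integral_add_adjacent_intervals (hc.intervalIntegrable (23 / 5) r) (hc.intervalIntegrable r (r + 2)),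
    ← intervalIntegral.integral_add_adjacent_intervals (hc.intervalIntegrable (23 / 5) (5)) (hc.intervalIntegrable (5) r)]
  have e1 : ∫ s in (23 / 5 : ℝ)..(5), gInt6 r s = (6 * tailConst5)⁻¹ * H6B1 r := by
    rw [← integral_H6B1, ← intervalIntegral.integral_const_mul]
    refine intervalIntegral.integral_congr fun s hs => ?_
    rw [uIcc_of_le (by norm_num)] at hs
    simp only [gInt6]
    rw [ramp6_of_mem hs.1 hs.2, abs_of_nonneg (by linarith [hs.2]), ← integrand_cU1]
  have e2 : ∫ s in (5 : ℝ)..r, gInt6 r s = (6 * tailConst5)⁻¹ * H6B2 r := by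
    rw [← integral_H6B2, ← intervalIntegral.integral_const_mul]
    refine intervalIntegral.integral_congr fun s hs => ?_
    rw [uIcc_of_le h1] at hs
    simp only [gInt6]
    rw [ramp6_of_ge hs.1, mul_one, abs_of_nonneg (by linarith [hs.2]), ← integrand_cU2]
  have e3 : ∫ s in r..(r + 2), gInt6 r s = (6 * tailConst5)⁻¹ * H6B3 r := by
    rw [← integral_H6B3, ← intervalIntegral.integral_const_mul]
    refine intervalIntegral.integral_congr fun s hs => ?_
    rw [uIcc_of_le (by linarith)] at hs
    simp only [gInt6]
    rw [ramp6_of_ge (by linarith [hs.1]), mul_one, abs_of_nonpos (by linarith [hs.1]), neg_sub, ← integrand_cU3]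
  rw [e1, e2, e3]; ring

/-- Kind C (`33/5 ≤ r ≤ 7`): `∫_{r−2}^{r+2} gInt6 r = (6M)⁻¹ (H6C1 + H6C2 + H6C3)(r)`. [folklore] -/
theorem window6_C {r : ℝ} (h1 : 33 / 5 ≤ r) (h2 : r ≤ 7) :
    ∫ s in (r - 2)..(r + 2), gInt6 r s = (6 * tailConst5)⁻¹ * (H6C1 r + H6C2 r + H6C3 r) := by
  have hc := continuous_gInt6 r
  rw [← intervalIntegral.integral_add_adjacent_intervals (hc.intervalIntegrable (r - 2) r) (hc.intervalIntegrable r (r + 2)),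
    ← intervalIntegral.integral_add_adjacent_intervals (hc.intervalIntegrable (r - 2) (5)) (hc.intervalIntegrable (5) r)]
  have e1 : ∫ s in (r - 2)..(5 : ℝ), gInt6 r s = (6 * tailConst5)⁻¹ * H6C1 r := by
    rw [← integral_H6C1, ← intervalIntegral.integral_const_mul]
    refine intervalIntegral.integral_congr fun s hs => ?_
    rw [uIcc_of_le (by linarith)] at hs
    simp only [gInt6]
    rw [ramp6_of_mem (by linarith [hs.1]) hs.2, abs_of_nonneg (by linarith [hs.2]), ← integrand_cU1]
  have e2 : ∫ s in (5 : ℝ)..r, gInt6 r s = (6 * tailConst5)⁻¹ * H6C2 r := by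
    rw [← integral_H6C2, ← intervalIntegral.integral_const_mul]
    refine intervalIntegral.integral_congr fun s hs => ?_
    rw [uIcc_of_le (by linarith)] at hs
    simp only [gInt6]
    rw [ramp6_of_ge hs.1, mul_one, abs_of_nonneg (by linarith [hs.2]), ← integrand_cU2]
  have e3 : ∫ s in r..(r + 2), gInt6 r s = (6 * tailConst5)⁻¹ * H6C3 r := by
    rw [← integral_H6C3, ← intervalIntegral.integral_const_mul]
    refine intervalIntegral.integral_congr fun s hs => ?_
    rw [uIcc_of_le (by linarith)] at hs
    simp only [gInt6]
    rw [ramp6_of_ge (by linarith [hs.1]), mul_one, abs_of_nonpos (by linarith [hs.1]), neg_sub, ← integrand_cU3]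
  rw [e1, e2, e3]; ring

/-! ## §4. From a certificate to the near-field inequality, and the assembly -/

/-- From a certificate `r·sec(r)·w ≤ 6K₀·Gs` (with `w = w₆ r`, `sec` the secant of `r⁻⁶` on `[u, v] ∋ r`) and the window bound
`(6M)⁻¹·Gs ≤ ∫_{s>0} sInt6 r` to the near-field inequality at `r` (the constant identity is the range-5 one, `a = 1`). [folklore] -/
theorem near_of_cert6 {u v r Gs wv : ℝ} (hu : 0 < u) (huv : u < v) (h1 : u ≤ r) (h2 : r ≤ v) (hr : 4 < r)
    (hwv : cutWeight smoothstep₂ 4 6 r = wv)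
    (hF : r * (((u⁻¹) ^ 6 * (v - r) + (v⁻¹) ^ 6 * (r - u)) / (v - u)) * wv ≤ 6 * (11025 / 20790 : ℝ) * Gs)
    (hwin : (6 * tailConst5)⁻¹ * Gs ≤ ∫ s in Ioi 0, sInt6 r s) :
    -(tailPot (cutWeight smoothstep₂ 4 6) r) ≤ 512 * π / 3465 *
      (2 * π / r * ∫ s in Ioi 0, s * kappa6 s * ∫ τ in |r - s|..(r + s), τ * omega₂ τ) := by
  have hr0 : 0 < r := by linarith
  subst hwv
  have hI : ∫ s in Ioi 0, s * kappa6 s * ∫ τ in |r - s|..(r + s), τ * omega₂ τ = ∫ s in Ioi 0, sInt6 r s := rfl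
  rw [hI]
  have hw := w6_mem_Icc r
  -- step 1: −(V·w)(r) ≤ (r⁻¹)^6/6 · w
  have hL : -(tailPot (cutWeight smoothstep₂ 4 6) r) ≤ (r⁻¹) ^ 6 / 6 * cutWeight smoothstep₂ 4 6 r := by
    unfold tailPot lennardJones
    have hy : 0 ≤ (r⁻¹) ^ 12 := by positivity
    nlinarith [hw.1, hw.2, hy, mul_nonneg hy hw.1]
  -- step 2: secant
  have hsec := inv_pow_six_le_secant hu huv h1 h2
  have hL2 : (r⁻¹) ^ 6 / 6 * cutWeight smoothstep₂ 4 6 r ≤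
      (((u⁻¹) ^ 6 * (v - r) + (v⁻¹) ^ 6 * (r - u)) / (v - u)) / 6 * cutWeight smoothstep₂ 4 6 r :=
    mul_le_mul_of_nonneg_right (div_le_div_of_nonneg_right hsec (by norm_num)) hw.1
  -- step 3: certificate and window
  have hC : 0 ≤ (512 * π / 3465) * (2 * π / r) := by positivity
  have hK := const_identity5
  calc -(tailPot (cutWeight smoothstep₂ 4 6) r)
        ≤ (((u⁻¹) ^ 6 * (v - r) + (v⁻¹) ^ 6 * (r - u)) / (v - u)) / 6 * cutWeight smoothstep₂ 4 6 r := hL.trans hL2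
    _ = (r * (((u⁻¹) ^ 6 * (v - r) + (v⁻¹) ^ 6 * (r - u)) / (v - u)) * cutWeight smoothstep₂ 4 6 r) / (6 * r) := by field_simp
    _ ≤ (6 * (11025 / 20790 : ℝ) * Gs) / (6 * r) := div_le_div_of_nonneg_right hF (by positivity)
    _ = (512 * π / 3465) * (2 * π / r) * ((6 * tailConst5)⁻¹ * Gs) := by
        rw [show (6 * tailConst5)⁻¹ = 11025 / 20790 / ((512 * π / 3465) * (2 * π)) by
          rw [← hK]; field_simp]
        field_simp
    _ ≤ (512 * π / 3465) * (2 * π / r) * ∫ s in Ioi 0, sInt6 r s := mul_le_mul_of_nonneg_left hwin hC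
    _ = _ := by ring

/-- ★★ **`SF₆` HOLDS** — the range-6 Schur tail floor `SchurFloor (cutWeight smoothstep₂ 4 6) omega₂ (13/8000)`: for EVERY finite configuration of
points in `ℝ³`, `−(13/8000)·(N + 2·Σ_{i<j} omega₂(r_ij)) ≤ Σ_{i<j} (V·w₆)(r_ij)` (per-site Schur slack `5.15·10⁻⁴` at the close packings).
[folklore: Schur test + certified elementary one-variable inequality] -/
theorem sf₆_holds : SchurFloor (cutWeight smoothstep₂ 4 6) omega₂ (13 / 8000) := by
  refine sf₆_of_nearIneq6 fun r hr1 hr2 => ?_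
  have hr4 : 4 ≤ r := hr1.le
  have winA0 : r ≤ 23 / 5 → (6 * tailConst5)⁻¹ * (H6A01 r + H6A02 r) ≤ ∫ s in Ioi 0, sInt6 r s := fun h => by
    rw [← window6_A0 hr4 h]; exact window_le_integral6 hr4 le_rfl (by linarith) (by linarith) (by linarith)
  have winA : 23 / 5 ≤ r → r ≤ 5 → (6 * tailConst5)⁻¹ * (H6A1 r + H6A2 r + H6A3 r) ≤ ∫ s in Ioi 0, sInt6 r s := fun h h' => by
    rw [← window6_A h h']; exact window_le_integral6 hr4 le_rfl (by linarith) (by linarith) (by linarith)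
  have winB : 5 ≤ r → r ≤ 33 / 5 → (6 * tailConst5)⁻¹ * (H6B1 r + H6B2 r + H6B3 r) ≤ ∫ s in Ioi 0, sInt6 r s := fun h h' => by
    rw [← window6_B h]; exact window_le_integral6 hr4 le_rfl (by linarith) (by linarith) (by linarith)
  have winC : 33 / 5 ≤ r → r ≤ 7 → (6 * tailConst5)⁻¹ * (H6C1 r + H6C2 r + H6C3 r) ≤ ∫ s in Ioi 0, sInt6 r s := fun h h' => by
    rw [← window6_C h h']; exact window_le_integral6 hr4 (by linarith) le_rfl (by linarith) (by linarith)
  rcases le_or_gt r (23 / 5) with c1 | c1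
  · exact near_of_cert6 (by norm_num) (by norm_num) hr4 c1 hr1 (w6_eq_quintic hr4 (by linarith)) (cert6_1 hr4 c1) (winA0 c1)
  rcases le_or_gt r 5 with c2 | c2
  · exact near_of_cert6 (by norm_num) (by norm_num) c1.le c2 hr1 (w6_eq_quintic hr4 (by linarith)) (cert6_2 c1.le c2) (winA c1.le c2)
  rcases le_or_gt r (21 / 4) with c3 | c3
  · exact near_of_cert6 (by norm_num) (by norm_num) c2.le c3 hr1 (w6_eq_quintic hr4 (by linarith)) (cert6_3 c2.le c3) (winB c2.le (by linarith))
  rcases le_or_gt r (11 / 2) with c4 | c4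
  · exact near_of_cert6 (by norm_num) (by norm_num) c3.le c4 hr1 (w6_eq_quintic hr4 (by linarith)) (cert6_4 c3.le c4) (winB (by linarith) (by linarith))
  rcases le_or_gt r 6 with c5 | c5
  · exact near_of_cert6 (by norm_num) (by norm_num) c4.le c5 hr1 (w6_eq_quintic hr4 c5) (cert6_5 c4.le c5) (winB (by linarith) (by linarith))
  rcases le_or_gt r (33 / 5) with c6 | c6
  · exact near_of_cert6 (by norm_num) (by norm_num) c5.le c6 hr1 (w6_eq_one c5.le) (cert6_6 c5.le c6) (winB (by linarith) c6)
  · exact near_of_cert6 (by norm_num) (by norm_num) c6.le hr2 hr1 (w6_eq_one (by linarith)) (cert6_7 c6.le hr2) (winC c6.le hr2)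

end Summit.AtomisticToContinuum.Crystallization.Theorems.FrustratedLawDichotomyBumpAutocorrelation

end
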